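import Literature.Geometry.Manifold.PatchSystem
import Literature.Analysis.PDE.SobolevTransport
import Literature.Analysis.PDE.CutoffCalculus
import HarnessLib

/-!
# Localisation of functions on a manifold to a patch system and transport of the localised
# pieces between patches (topic `Analysis/PDE`)

Analytic–geometric layer of the programme to prove short-time existence for quasilinear
strictly parabolic systems on a closed manifold (hypothesis `hQL` of
`Literature.Geometry.Riemannian.ricciFlow_shortTime_existence_of_quasilinear`). The a priori
estimates of that programme measure a function `f` on `M` through the cut-off own-chart
expressions `w_p = (cut_p • f) ∘ κ_p⁻¹` of a patch system (`PatchSystem.cutExpr`); terms of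
lower order that live on the support of a cut-off in a patch `q` are re-expressed through the
`w_p` of ALL patches with the partition of unity `ρ` (supported where `cut = 1`):

  `θ(y) • f(κ_q⁻¹ y) = Σ_p (θ · ρ_p∘κ_q⁻¹)(y) • w_p(τ_{qp} y)`   (`localization_identity`),

and each summand is a transport in the sense of `SobolevTransport.lean`, with a multiplier
supported compactly inside the overlap; hence for every order `k` and every smooth cut-off `θ`
supported in the target of `κ_q` there is `C < ∞` with

  `E_k(y ↦ (θ · ρ_p∘κ_q⁻¹)(y) • g(τ_{qp} y)) ≤ C E_k(g)`   (`sobolevEnergy_transport_le`)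

for all smooth `g` on the model. This is the bookkeeping by which constants of transport
between charts enter only lower-order terms of the estimates.

Everything is proved; no named fact and no `sorry` is introduced.

## References

* J. M. Lee, *Introduction to Smooth Manifolds*, 2nd ed., Springer 2013, Thm. 2.23. [Lee2013]
* R. A. Adams, *Sobolev Spaces*, Academic Press 1975, Thm. 3.35. [Adams1975]
-/

noncomputable section

open Set Function Filter Topology Metric MeasureTheory
open scoped Manifold ContDiff Topology ENNReal

namespace Literature.Analysis.PDE

open Literature.Geometry.Manifold

variable {E : Type*} [NormedAddCommGroup E] [NormedSpace ℝ E] {H : Type*} [TopologicalSpace H]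
variable {I : ModelWithCorners ℝ E H} {M : Type*} [TopologicalSpace M] [ChartedSpace H M]
variable {E' : Type*} [NormedAddCommGroup E'] [InnerProductSpace ℝ E'] [FiniteDimensional ℝ E']
variable {F : Type*} [NormedAddCommGroup F] [NormedSpace ℝ F]
variable {ι : Type*} [Fintype ι] (P : PatchSystem I M E' ι)

namespace PatchSystemLoc

/-! ### The partition functions read in another chart -/

open Classical in
/-- `ρ_p` read in the chart `q`, zero-extended off the target of `q`. [cite: Lee2013, Thm. 2.23] -/
def rhoIn (q p : ι) (y : E') : ℝ := if y ∈ (P.chart q).target then P.rho p ((P.chart q).inv y) else 0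

/-- `rhoIn_of_mem`: rhoIn of mem. [folklore] -/
theorem rhoIn_of_mem {q p : ι} {y : E'} (hy : y ∈ (P.chart q).target) :
    rhoIn P q p y = P.rho p ((P.chart q).inv y) := by
  simp [rhoIn, hy]

/-- `rhoIn_of_notMem`: rhoIn of notMem. [folklore] -/
theorem rhoIn_of_notMem {q p : ι} {y : E'} (hy : y ∉ (P.chart q).target) : rhoIn P q p y = 0 := by
  simp [rhoIn, hy]

/-- `sum_rhoIn`: sum rhoIn. [folklore] -/
theorem sum_rhoIn {q : ι} {y : E'} (hy : y ∈ (P.chart q).target) : ∑ p, rhoIn P q p y = 1 := by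
  simp only [rhoIn_of_mem P hy]
  exact P.sum_rho _

/-- `contDiffOn_rhoIn`: contDiffOn rhoIn. [folklore] -/
theorem contDiffOn_rhoIn [IsManifold I ∞ M] [I.Boundaryless] [T2Space M] (q p : ι) :
    ContDiffOn ℝ ∞ (rhoIn P q p) (P.chart q).target :=
  (P.contDiffOn_rho_comp_inv p q).congr fun _ hy ↦ rhoIn_of_mem P hy

/-- Where `rhoIn q p ≠ 0`, the point charts back into the source of `p`, inside the support
ball of the bump of `p`. [folklore] -/
theorem mem_of_rhoIn_ne_zero {q p : ι} {y : E'} (hy : rhoIn P q p y ≠ 0) :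
    y ∈ (P.chart q).target ∧ (P.chart q).inv y ∈ (P.chart p).source ∧
      (P.chart p).map ((P.chart q).inv y) ∈ ball (0 : E') (2 * P.r p) := by
  by_cases hyt : y ∈ (P.chart q).target
  · rw [rhoIn_of_mem P hyt] at hy
    exact ⟨hyt, P.mem_of_rho_ne_zero p hy⟩
  · exact absurd (rhoIn_of_notMem P hyt) hy

/-! ### Own-chart cut-off expressions -/

open Classical in
/-- **The cut-off own-chart expression** `w_p = (cut_p • f) ∘ κ_p⁻¹` of a function `f` on `M`,
zero-extended to the model. [cite: Lee2013, Thm. 2.23] -/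
def cutExpr (p : ι) (f : M → F) (y : E') : F :=
  if y ∈ (P.chart p).target then P.cut p y • f ((P.chart p).inv y) else 0

/-- `cutExpr_of_mem`: cutExpr of mem. [folklore] -/
theorem cutExpr_of_mem {p : ι} (f : M → F) {y : E'} (hy : y ∈ (P.chart p).target) :
    cutExpr P p f y = P.cut p y • f ((P.chart p).inv y) := by
  simp [cutExpr, hy]

/-- `cutExpr_of_notMem`: cutExpr of notMem. [folklore] -/
theorem cutExpr_of_notMem {p : ι} (f : M → F) {y : E'} (hy : y ∉ (P.chart p).target) :
    cutExpr P p f y = 0 := by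
  simp [cutExpr, hy]

/-- The cut-off expression is the plain product `cut_p • (f ∘ κ_p⁻¹)` everywhere (off the target the
cut-off vanishes). [folklore] -/
theorem cutExpr_eq_smul (p : ι) (f : M → F) :
    cutExpr P p f = fun y ↦ P.cut p y • f ((P.chart p).inv y) := by
  funext y
  by_cases hy : y ∈ (P.chart p).target
  · exact cutExpr_of_mem P f hy
  · rw [cutExpr_of_notMem P f hy]
    have h0 : P.cut p y = 0 := image_eq_zero_of_notMem_tsupport fun h ↦ hy (P.tsupport_cut_subset p h)
    rw [h0, zero_smul]

/-- On `κ_p(x)` with `cut_p(κ_p x) = 1` the cut-off expression is `f x`. [folklore] -/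
theorem cutExpr_map_of_cut_eq_one {p : ι} (f : M → F) {x : M} (hx : x ∈ (P.chart p).source)
    (h1 : P.cut p ((P.chart p).map x) = 1) : cutExpr P p f ((P.chart p).map x) = f x := by
  rw [cutExpr_of_mem P f ((P.chart p).map_mem_target hx), h1, one_smul, (P.chart p).inv_map hx]

/-- The cut-off expression vanishes off `ball 0 (3rₚ)`. [folklore] -/
theorem cutExpr_eq_zero {p : ι} (f : M → F) {y : E'} (hy : y ∉ ball (0 : E') (3 * P.r p)) :
    cutExpr P p f y = 0 := by
  by_cases hyt : y ∈ (P.chart p).target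
  · rw [cutExpr_of_mem P f hyt]
    have h : P.cut p y = 0 := by
      have h' : y ∉ Function.support (P.cut p) := by rwa [ContDiffBump.support_eq, P.cut_rOut]
      simpa using h'
    rw [h, zero_smul]
  · exact cutExpr_of_notMem P f hyt

/-- `tsupport_cutExpr_subset`: tsupport cutExpr subset. [folklore] -/
theorem tsupport_cutExpr_subset {p : ι} (f : M → F) :
    tsupport (cutExpr P p f) ⊆ closedBall (0 : E') (3 * P.r p) := by
  rw [← closure_ball (0 : E') (mul_pos three_pos (P.r_pos p)).ne']
  exact closure_mono fun y hy ↦ by_contra fun h ↦ hy (cutExpr_eq_zero P f h)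

/-- `hasCompactSupport_cutExpr`: hasCompactSupport cutExpr. [folklore] -/
theorem hasCompactSupport_cutExpr {p : ι} (f : M → F) : HasCompactSupport (cutExpr P p f) :=
  (isCompact_closedBall (0 : E') _).of_isClosed_subset (isClosed_tsupport _)
    (tsupport_cutExpr_subset P f)

/-- **The cut-off expression of a function with smooth chart expression is smooth on the
model.** [cite: Lee2013, Thm. 2.23] -/
theorem contDiff_cutExpr [I.Boundaryless] {p : ι} {f : M → F}
    (hf : ContDiffOn ℝ ∞ (f ∘ (P.chart p).inv) (P.chart p).target) :
    ContDiff ℝ ∞ (cutExpr P p f) := by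
  -- the globally smooth product `cut • (f ∘ inv)`
  have hs : ContDiff ℝ ∞ fun y ↦ P.cut p y • (f ∘ (P.chart p).inv) y :=
    contDiff_smul_of_tsupport_subset (P.chart p).isOpen_target (P.cut p).contDiff
      (P.tsupport_cut_subset p) hf
  refine contDiff_iff_contDiffAt.2 fun y ↦ ?_
  by_cases hy : y ∈ (P.chart p).target
  · refine hs.contDiffAt.congr_of_eventuallyEq ?_
    filter_upwards [(P.chart p).isOpen_target.mem_nhds hy] with y₁ hy₁
    exact cutExpr_of_mem P f hy₁
  · have hy' : y ∉ closedBall (0 : E') (4 * P.r p) := fun h ↦ hy (P.closedBall_subset p h)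
    have hO : IsOpen (closedBall (0 : E') (3 * P.r p))ᶜ := isClosed_closedBall.isOpen_compl
    have hyO : y ∈ (closedBall (0 : E') (3 * P.r p))ᶜ := fun h ↦
      hy' (closedBall_subset_closedBall (by nlinarith [P.r_pos p]) h)
    refine (contDiffAt_const (c := (0 : F))).congr_of_eventuallyEq ?_
    filter_upwards [hO.mem_nhds hyO] with y₁ hy₁
    exact image_eq_zero_of_notMem_tsupport fun h ↦ hy₁ (tsupport_cutExpr_subset P f h)

/-! ### The localisation identity -/

/-- **Localisation identity**: for `y` in the target of `κ_q`,
`f(κ_q⁻¹ y) = Σ_p ρ_p(κ_q⁻¹ y) • w_p(τ_{qp} y)` with `w_p = cutExpr p f` (since `Σ ρ_p = 1` and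
`cut_p = 1` on the support of `ρ_p`). [cite: Lee2013, Thm. 2.23] -/
theorem localization_identity (f : M → F) {q : ι} {y : E'} (hy : y ∈ (P.chart q).target) :
    f ((P.chart q).inv y) =
      ∑ p, rhoIn P q p y • cutExpr P p f ((P.chart q).transition (P.chart p) y) := by
  have h1 : f ((P.chart q).inv y) = ∑ p, rhoIn P q p y • f ((P.chart q).inv y) := by
    rw [← Finset.sum_smul, sum_rhoIn P hy, one_smul]
  rw [h1]
  refine Finset.sum_congr rfl fun p _ ↦ ?_
  by_cases hp : rhoIn P q p y = 0
  · rw [hp, zero_smul, zero_smul]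
  · obtain ⟨_, hs, _⟩ := mem_of_rhoIn_ne_zero P hp
    congr 1
    rw [FramedChart.transition_apply]
    rw [rhoIn_of_mem P hy] at hp
    exact (cutExpr_map_of_cut_eq_one P f hs (P.cut_map_eq_one_of_rho_ne_zero p hp)).symm

/-- The localisation identity with an additional multiplier `θ`. [cite: Lee2013, Thm. 2.23] -/
theorem localization_identity_smul (θ : E' → ℝ) (f : M → F) {q : ι} {y : E'}
    (hy : y ∈ (P.chart q).target) :
    θ y • f ((P.chart q).inv y) =
      ∑ p, (θ y * rhoIn P q p y) • cutExpr P p f ((P.chart q).transition (P.chart p) y) := by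
  rw [localization_identity P f hy, Finset.smul_sum]
  simp_rw [smul_smul]

/-! ### Transport of the localised pieces -/

section Transport

variable [MeasurableSpace E'] [BorelSpace E'] [IsManifold I ∞ M] [I.Boundaryless] [T2Space M]

omit [MeasurableSpace E'] [BorelSpace E'] [IsManifold I ∞ M] [I.Boundaryless] in
/-- **The compact set inside the overlap carrying the localised multipliers**: for `Cθ` compact
in the target of `κ_q` there is a compact `K ⊆ overlap q p` containing
`Cθ ∩ tsupport (ρ_p∘κ_q⁻¹)` (`K = κ_q (κ_q⁻¹ Cθ ∩ κ_p⁻¹ closedBall(2rₚ))`). [folklore] -/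
theorem exists_compact_inter_tsupport_rhoIn_subset {q : ι} {Cθ : Set E'} (hCθ : IsCompact Cθ)
    (hCθt : Cθ ⊆ (P.chart q).target) (p : ι) :
    ∃ K : Set E', IsCompact K ∧ K ⊆ (P.chart q).overlap (P.chart p) ∧
      Cθ ∩ tsupport (rhoIn P q p) ⊆ K := by
  obtain ⟨hC1, hC1s⟩ := (P.chart q).isCompact_image_inv hCθ hCθt
  obtain ⟨hC2, hC2s⟩ := (P.chart p).isCompact_image_inv (isCompact_closedBall (0 : E') (2 * P.r p))
    (P.closedBall_subset_target p (by norm_num))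
  set KM : Set M := (P.chart q).inv '' Cθ ∩ (P.chart p).inv '' closedBall (0 : E') (2 * P.r p)
  have hKM : IsCompact KM := hC1.inter_right hC2.isClosed
  have hKMq : KM ⊆ (P.chart q).source := fun x hx ↦ hC1s hx.1
  have hKMp : KM ⊆ (P.chart p).source := fun x hx ↦ hC2s hx.2
  obtain ⟨hK, _⟩ := (P.chart q).isCompact_image_map hKM hKMq
  refine ⟨(P.chart q).map '' KM, hK, ?_, ?_⟩
  · rintro y ⟨x, hx, rfl⟩
    exact (P.chart q).map_mem_overlap (P.chart p) (hKMq hx) (hKMp hx)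
  · rintro y ⟨hyC, hyρ⟩
    have hyt : y ∈ (P.chart q).target := hCθt hyC
    -- `κ_q⁻¹ y` lies in the closed set `κ_p⁻¹ closedBall(2rₚ)`: limit of points where `ρ_p ≠ 0`
    have hcl : (P.chart q).inv y ∈ (P.chart p).inv '' closedBall (0 : E') (2 * P.r p) := by
      have hsub : (P.chart q).inv '' Function.support (rhoIn P q p) ⊆
          (P.chart p).inv '' closedBall (0 : E') (2 * P.r p) := by
        rintro x ⟨z, hz, rfl⟩
        obtain ⟨_, hzs, hzb⟩ := mem_of_rhoIn_ne_zero P hz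
        exact ⟨(P.chart p).map ((P.chart q).inv z), ball_subset_closedBall hzb, (P.chart p).inv_map hzs⟩
      have hcont : ContinuousWithinAt (P.chart q).inv (Function.support (rhoIn P q p)) y :=
        ((P.chart q).continuousOn_inv y hyt).mono fun z hz ↦ (mem_of_rhoIn_ne_zero P hz).1
      have h := hcont.mem_closure_image hyρ
      rw [← hC2.isClosed.closure_eq]
      exact closure_mono hsub h
    exact ⟨(P.chart q).inv y, ⟨⟨y, hyC, rfl⟩, hcl⟩, (P.chart q).map_inv hyt⟩

omit [MeasurableSpace E'] [BorelSpace E'] [IsManifold I ∞ M] [I.Boundaryless] in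
/-- The compact set inside the overlap carrying the multiplier `θ · ρ_p∘κ_q⁻¹`. [folklore] -/
theorem exists_compact_multiplier_support {q : ι} {θ : E' → ℝ} {Cθ : Set E'} (hCθ : IsCompact Cθ)
    (hCθt : Cθ ⊆ (P.chart q).target) (hθC : tsupport θ ⊆ Cθ) (p : ι) :
    ∃ K : Set E', IsCompact K ∧ K ⊆ (P.chart q).overlap (P.chart p) ∧
      tsupport (fun y ↦ θ y * rhoIn P q p y) ⊆ K := by
  obtain ⟨K, hK, hKV, hsub⟩ := exists_compact_inter_tsupport_rhoIn_subset P hCθ hCθt p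
  refine ⟨K, hK, hKV, fun y hy ↦ hsub ⟨hθC ?_, ?_⟩⟩
  · exact tsupport_mul_subset_left hy
  · exact tsupport_mul_subset_right hy

omit [T2Space M] in
/-- **Transport bound with a general multiplier**: for a smooth multiplier `m` with `tsupport m`
inside a compact subset of the overlap `overlap q p` and every order `k` there is `C < ∞` with
`E_k(y ↦ m(y) • g(τ_{qp} y)) ≤ C E_k(g)` for all smooth `g` on the model.
[cite: Adams1975, Thm. 3.35] -/
theorem sobolevEnergy_smul_comp_transition_le {q : ι} (p : ι) {m : E' → ℝ} (hm : ContDiff ℝ ∞ m)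
    {K : Set E'} (hK : IsCompact K) (hKV : K ⊆ (P.chart q).overlap (P.chart p)) (hmK : tsupport m ⊆ K)
    (k : ℕ) :
    ∃ C : ℝ≥0∞, C ≠ ⊤ ∧ ∀ {g : E' → F}, ContDiff ℝ ∞ g →
      sobolevEnergy k (fun y ↦ m y • g ((P.chart q).transition (P.chart p) y)) ≤ C * sobolevEnergy k g :=
  sobolevEnergy_smul_comp_le ((P.chart q).isOpen_overlap (P.chart p))
    ((P.chart q).contDiffOn_transition (P.chart p)) ((P.chart q).injOn_transition (P.chart p))
    (fun _ hy ↦ (P.chart q).det_fderiv_transition_ne_zero (P.chart p) hy) hK hKV hm hmK k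

omit [MeasurableSpace E'] [BorelSpace E'] in
/-- The multiplier `θ · ρ_p∘κ_q⁻¹` is globally smooth for `θ` smooth with support inside the target.
[folklore] -/
theorem contDiff_mul_rhoIn {q : ι} {θ : E' → ℝ} (hθ : ContDiff ℝ ∞ θ)
    (hθt : tsupport θ ⊆ (P.chart q).target) (p : ι) : ContDiff ℝ ∞ fun y ↦ θ y * rhoIn P q p y := by
  have h := contDiff_smul_of_tsupport_subset (P.chart q).isOpen_target hθ hθt (contDiffOn_rhoIn P q p)
  simpa only [smul_eq_mul] using h

/-- **Transport bound for localised pieces**: for a smooth multiplier `θ` supported in a compact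
subset of the target of `κ_q` and every order `k` there is `C < ∞` with
`E_k(y ↦ (θ · ρ_p∘κ_q⁻¹)(y) • g(τ_{qp} y)) ≤ C E_k(g)` for all smooth `g` on the model.
[cite: Adams1975, Thm. 3.35] -/
theorem sobolevEnergy_transport_le {q : ι} {θ : E' → ℝ} (hθ : ContDiff ℝ ∞ θ) {Cθ : Set E'}
    (hCθ : IsCompact Cθ) (hCθt : Cθ ⊆ (P.chart q).target) (hθC : tsupport θ ⊆ Cθ) (p : ι)
    (k : ℕ) :
    ∃ C : ℝ≥0∞, C ≠ ⊤ ∧ ∀ {g : E' → F}, ContDiff ℝ ∞ g →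
      sobolevEnergy k (fun y ↦ (θ y * rhoIn P q p y) •
        g ((P.chart q).transition (P.chart p) y)) ≤ C * sobolevEnergy k g := by
  obtain ⟨K, hK, hKV, hsupp⟩ := exists_compact_multiplier_support P hCθ hCθt hθC p
  exact sobolevEnergy_smul_comp_transition_le P p (contDiff_mul_rhoIn P hθ (hθC.trans hCθt) p)
    hK hKV hsupp k

end Transport

end PatchSystemLoc

end Literature.Analysis.PDE

end
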